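import Literature.AnabelianGeometry.AbsoluteAnabelian.LocalVolumesNonarchimedean
import Literature.IUT.LogThetaLattice.PacketLogVolumes
import HarnessLib

/-!
# [IUTchIII] Remark 3.9.2 at the local-field model: the «nonnegative elements» recovered from their effect on
# log-volumes are exactly the integers (proof-only companion of `PacketLogVolumes.lean`)

S. Mochizuki, *Inter-universal Teichmüller theory III*, kurims manuscript (May 2020), Remark 3.9.2, p. 119
[claim: Mochizuki2012, status: disputed]: "one may construct ['mono-analytic'] algorithms for recovering the
subquotient of the perfection of `(†𝕄⊛_mod)_α = (†𝕄⊛_MOD)_α` associated to `w ∈ 𝕍` [cf. Remark 3.6.1], together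
with the submonoid of 'nonnegative elements' of such a subquotient, by considering the effect of
multiplication by elements of `(†𝕄⊛_mod)_α` on the log-volumes defined on the various `𝓘^ℚ(^{A,α}𝓕_v) ≅
𝓘^ℚ(^{A,α}𝒟^⊢_v)`". abc-iut-L6-t4 typed the recovered set as
`Remark392_nonnegAt act vol := {f | ∀ S, vol (act f S) ≤ vol S}` (`PacketLogVolumes.lean`, p404053) over an
abstract action and an abstract log-volume.

THIS FILE computes that set AT THE MODEL of one nonarchimedean place (plan/L6/SUBDAG-IUTchIII-Prop-39.md,
Remarks census; seat abc-iut-w5-d178): the container is a nonarchimedean local field `K`, the action of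
`f ∈ K^×` is `S ↦ f·S`, and the log-volume is abc-iut-L4-t3's `localLogVolume K` ([AbsTopIII] Prop. 5.7 (i),
`LocalVolumesNonarchimedean.lean`: `μ_k^log(x·A) = μ_k^log(A) + μ̇_k^log(x)`, `μ̇_k(x) = |x|_k` the modulus).
RESULT **`remark392_nonnegAt_localField`**: `Remark392_nonnegAt (·•·) (localLogVolume K) = {f | ‖f‖ ≤ 1}` — the
elements whose multiplication never increases a log-volume are precisely those of norm `≤ 1`, i.e. the
nonnegative part `ord_w ≥ 0` of the value group: the printed recovery works, by `|f|_K ≤ 1 ⟺ ‖f‖ ≤ 1`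
(`distribHaarChar_le_one_iff_norm_le_one`, from the tree's `distribHaarChar_uniformizer` / `two_le_resIndex`,
Weil BNT I §4 Th. 6). Sets of zero or infinite volume carry `Real.log`'s junk value `0` on both sides and do
not disturb the characterisation (the unit ball alone detects `‖f‖ > 1`).

Classical; no new definitions; nothing here bears on the disputed [IUTchIII] Cor. 3.12 or takes a side.
[cite: MochizukiAbsTopIII2015, Prop. 5.7 (i)(b) p. 138] [cite: WeilBNT1967, Ch. I §4, Th. 6]
-/

noncomputable section

namespace Literature.IUT.LogThetaLattice

open MeasureTheory Set Metric
open scoped Pointwise NNReal ENNReal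
open Literature.NumberTheory.GaloisRepresentations.Ultrametric
open Literature.AnabelianGeometry.AbsoluteAnabelian

variable {K : Type*} [NontriviallyNormedField K] [IsUltrametricDist K] [ProperSpace K]

/-- **The modulus detects integrality**: `|f|_K ≤ 1 ⟺ ‖f‖ ≤ 1` for `f ∈ K^×` (if `‖f‖ > 1` then `‖f⁻¹‖ < 1`,
`|f⁻¹|_K = [𝒪 : f⁻¹𝒪]⁻¹ ≤ 1/2`, so `|f|_K ≥ 2`). [cite: WeilBNT1967, Ch. I §4, Th. 6] -/
theorem distribHaarChar_le_one_iff_norm_le_one (f : Kˣ) : distribHaarChar K f ≤ 1 ↔ ‖(f : K)‖ ≤ 1 := by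
  refine ⟨fun h => ?_, distribHaarChar_le_one_of_norm_le_one f⟩
  by_contra hlt
  push Not at hlt
  -- `‖f⁻¹‖ < 1`
  have hf0 : (f : K) ≠ 0 := f.ne_zero
  have hinv : ‖((f⁻¹ : Kˣ) : K)‖ < 1 := by
    rw [Units.val_inv_eq_inv_val, norm_inv]
    exact inv_lt_one_of_one_lt₀ hlt
  -- `|f⁻¹|_K = (resIndex f⁻¹)⁻¹ ≤ 1/2 < 1`, while `|f|_K · |f⁻¹|_K = 1` forces `|f⁻¹|_K ≥ 1`
  have hq := two_le_resIndex hinv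
  have hchar : distribHaarChar K (f⁻¹) = ((resIndex (f⁻¹) : ℝ≥0))⁻¹ :=
    distribHaarChar_uniformizer hinv.le
  have hmul : distribHaarChar K f * distribHaarChar K (f⁻¹) = 1 := by
    rw [← map_mul, mul_inv_cancel, map_one]
  have hge : 1 ≤ distribHaarChar K (f⁻¹) := by
    -- from `char f ≤ 1` and `char f * char f⁻¹ = 1`
    have hpos : 0 < distribHaarChar K f := distribHaarChar_pos
    calc (1 : ℝ≥0) = distribHaarChar K f * distribHaarChar K (f⁻¹) := hmul.symm
      _ ≤ 1 * distribHaarChar K (f⁻¹) := by gcongr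
      _ = distribHaarChar K (f⁻¹) := one_mul _
  rw [hchar] at hge
  have hq2 : (2 : ℝ≥0) ≤ (resIndex (f⁻¹) : ℝ≥0) := by exact_mod_cast hq
  have : ((resIndex (f⁻¹) : ℝ≥0))⁻¹ < 1 := by
    apply inv_lt_one_of_one_lt₀
    exact lt_of_lt_of_le (by norm_num) hq2
  exact absurd hge (not_le.mpr this)

variable [MeasurableSpace K] [BorelSpace K]

/-- `μ̇_k(f) ≤ 1 ⟺ ‖f‖ ≤ 1` for abc-iut-L4-t3's modulus `unitVolume K f = μ_k(f·𝒪_k) = |f|_K`.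
[cite: MochizukiAbsTopIII2015, Prop. 5.7 (i)(b) p. 138] -/
theorem unitVolume_le_one_iff (f : Kˣ) : unitVolume K f ≤ 1 ↔ ‖(f : K)‖ ≤ 1 := by
  rw [unitVolume_eq_distribHaarChar, ← distribHaarChar_le_one_iff_norm_le_one]
  exact_mod_cast Iff.rfl

/-- If `‖f‖ ≤ 1`, multiplication by `f` never increases abc-iut-L4-t3's log-volume `μ_k^log` — on EVERY subset
(`μ_k(f·S) = |f|_K · μ_k(S) ≤ μ_k(S)`; sets of zero or infinite volume give `log`'s junk value `0` on both
sides). [cite: MochizukiAbsTopIII2015, Prop. 5.7 (i)(b) p. 138] -/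
theorem localLogVolume_units_smul_le (f : Kˣ) (hf : ‖(f : K)‖ ≤ 1) (S : Set K) :
    localLogVolume K (f • S) ≤ localLogVolume K S := by
  have hu : unitVolume K f ≤ 1 := (unitVolume_le_one_iff f).mpr hf
  have hu0 : 0 < unitVolume K f := unitVolume_pos f
  have hmul : localVolume K (f • S) = unitVolume K f * localVolume K S := by
    rw [localVolume_units_smul, unitVolume_eq_distribHaarChar]
  unfold localLogVolume
  rw [hmul]
  by_cases hS : localVolume K S = 0
  · rw [hS, mul_zero]
  · have hSpos : 0 < localVolume K S := lt_of_le_of_ne ENNReal.toReal_nonneg (Ne.symm hS)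
    rw [Real.log_mul hu0.ne' hS]
    have : Real.log (unitVolume K f) ≤ 0 := Real.log_nonpos hu0.le hu
    linarith

/-- If `‖f‖ > 1`, multiplication by `f` strictly increases the log-volume of the unit ball:
`μ_k^log(f·𝒪_k) = log |f|_K > 0 = μ_k^log(𝒪_k)`. [cite: MochizukiAbsTopIII2015, Prop. 5.7 (i)(b) p. 138] -/
theorem localLogVolume_unitBall_lt_of_one_lt_norm (f : Kˣ) (hf : 1 < ‖(f : K)‖) :
    localLogVolume K (closedBall (0 : K) 1) < localLogVolume K (f • closedBall (0 : K) 1) := by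
  have hgt : 1 < unitVolume K f := by
    by_contra hle
    exact absurd ((unitVolume_le_one_iff f).mp (not_lt.mp hle)) (not_le.mpr hf)
  unfold localLogVolume
  rw [localVolume_closedBall_one, Real.log_one]
  change 0 < Real.log (unitVolume K f)
  exact Real.log_pos hgt

/-- **[IUTchIII] Remark 3.9.2 at the model of one nonarchimedean place.** With the container a nonarchimedean
local field `K`, the action `f ↦ (S ↦ f·S)` of `f ∈ K^×` and abc-iut-L4-t3's log-volume `μ_k^log`, abc-iut-L6-t4's
recovered set of «nonnegative elements» `Remark392_nonnegAt` IS the valuation-nonnegative part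
`{f | ‖f‖ ≤ 1}` (= `{ord_w(f) ≥ 0}`): "by considering the effect of multiplication … on the log-volumes" one
recovers exactly the submonoid of nonnegative elements. [claim: Mochizuki2012, status: disputed] -/
theorem remark392_nonnegAt_localField :
    Remark392_nonnegAt (fun (f : Kˣ) (S : Set K) => f • S) (localLogVolume K) = {f : Kˣ | ‖(f : K)‖ ≤ 1} := by
  ext f
  simp only [Remark392_nonnegAt, Set.mem_setOf_eq]
  constructor
  · intro h
    by_contra hlt
    exact absurd (h (closedBall (0 : K) 1)) (not_le.mpr (localLogVolume_unitBall_lt_of_one_lt_norm f (not_le.mp hlt)))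
  · intro hf S
    exact localLogVolume_units_smul_le f hf S

/-- In particular the recovered set is a submonoid containing the units `𝒪_k^×` and closed under
multiplication (`‖fg‖ = ‖f‖‖g‖ ≤ 1`) — the «submonoid of nonnegative elements».
[claim: Mochizuki2012, status: disputed] -/
theorem remark392_nonnegAt_localField_mul_mem {f g : Kˣ}
    (hf : f ∈ Remark392_nonnegAt (fun (f : Kˣ) (S : Set K) => f • S) (localLogVolume K))
    (hg : g ∈ Remark392_nonnegAt (fun (f : Kˣ) (S : Set K) => f • S) (localLogVolume K)) :
    f * g ∈ Remark392_nonnegAt (fun (f : Kˣ) (S : Set K) => f • S) (localLogVolume K) := by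
  rw [remark392_nonnegAt_localField] at hf hg ⊢
  simp only [Set.mem_setOf_eq, Units.val_mul, norm_mul] at hf hg ⊢
  exact mul_le_one₀ hf (norm_nonneg _) hg

end Literature.IUT.LogThetaLattice

end
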